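import Literature.Probability.Percolation.QSMStatic
import HarnessLib

/-!
# Lifting the exploration to `ℤ³`: heights, designated lifts and the bonus probe
# (Martineau–Severo 2019, §5, for the covering `ℤ³ → C_n □ ℤ²`)

Sixth file of the inline proof of `Literature.Probability.Percolation.martineauSevero_zd3_slabTorus`.
Martineau–Severo (Ann. Probab. 47 (2019), §5) lift the exploration of the enhanced cluster of `ℋ`
to the cover `𝒢`: each `p`-explored `ℋ`-edge `e` gets ONE lift `e'` whose coins are read
(Condition 1: "there is a lift `e'` of `e` such that the set of the `p`-explored lifts of `e` is
precisely `{e'} × {1,…,M}`"), and the `s`-exploration of a vertex `u` whose ball is fully open reads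
fresh coins on NON-designated lifts inside `π⁻¹(B_r(u))` (the set `Z(x, r)` of Lemma 5.1, which is
adjacent to two lifts of every vertex of `S_{r+1}(u)` by the disjoint tree-lifting property).

For `π : ℤ³ → ℋ_n`, `(t, y) ↦ (t mod n, y)`, this file provides the deterministic bookkeeping of
that lift as functions of the Boolean transcript (`QSMExploration.lean`):

* `SlabTorus.pi3`, `SlabTorus.lft` — the covering map and the lift `(z, y) ↦ (z, y₀, y₁)`;
  `pi3 (x + dvec d) = nbr (pi3 x) d` (`pi3_add_dvec`): `π` is a covering that lifts every
  direction.
* `SlabTorus.htOf L b : Vert n → ℤ` — the **height** of the chosen lift `λ(v) = lft (ht v) v.2` of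
  every explored vertex (Benjamini–Schramm's lift of the exploration tree): the far endpoint of an
  open explored edge is lifted through that edge; the vertices conquered by a column bonus are
  lifted to the sheets chosen by `jstar` (below).
* `SlabTorus.desig σ h e` — the **designated lift** of a queried `ℋ`-edge (M–S's `e'`), and
  `piE (desig e) = e`.
* The **bonus probe** `SlabTorus.Dcol σ h y` of a column `y` (M–S's `s`-exploration of `Z(x,r)` and
  of one fresh lift of each edge of `S_{r+1/2}(u)`), made of: the non-designated edges among the
  `4n` vertical edges of the line over `y` above the lift of `(0, y)` (four sheets: the wrap-around
  witness `Z`), a padding of designated-many further non-designated vertical edges above them (so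
  that the number of coins read is CONSTANT, replacing M–S's thinning `α_u := 1` with probability
  `s/q`), and, for each vertex `(t, y)` and horizontal direction, one NON-designated lift of the
  horizontal edge at a lift of `(t, y)` in a sheet of parity `χ(y) = (y₀ + y₁) mod 2` (two of the
  four sheets have that parity and at most one carries the designated lift; the parity rule replaces
  M–S's multigraph trick: a horizontal edge of `ℤ³` lies in one sheet and adjacent columns have
  opposite parity, so the bonus probes of different columns never share a coin);
  `card_Dcol : |Dcol| = 8n`.

## References

* S. Martineau, F. Severo, Ann. Probab. 47 (2019), §5 (Lemma 5.1; Structure of the process,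
  Conditions 1–5; Substeps of Step 2K+2) [MartineauSevero2019].
* I. Benjamini, O. Schramm, Electron. Comm. Probab. 1 (1996), Thm. 1 [BenjaminiSchramm1996].
-/

-- large but genuine `DecidableEq (Sym2 (Fin 3 → ℤ))`-type instances, as in `QSMStatic.lean`
set_option synthInstance.maxSize 1024

namespace Literature.Probability.Percolation

open LatticeModels

namespace SlabTorus

variable {n : ℕ}

/-! ### The covering map `π : ℤ³ → ℋ_n` and lifts -/

/-- The covering map `π : ℤ³ → C_n □ ℤ²`, `x ↦ (x₀ mod n, (x₁, x₂))`. [cite: MartineauSevero2019, §2 (the quotient map π)] -/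
def pi3 (n : ℕ) (x : Site 3) : Vert n := (((x 0 : ℤ) : ZMod n), tail3 x)

/-- The point of `ℤ³` of height `z` over the planar site `y`. [folklore] -/
def lft (z : ℤ) (y : Site 2) : Site 3 := Fin.cons z y

/-- Height of a lift. [folklore] -/
@[simp] theorem lft_zero (z : ℤ) (y : Site 2) : lft z y 0 = z := rfl

/-- Tail of a lift. [folklore] -/
@[simp] theorem tail3_lft (z : ℤ) (y : Site 2) : tail3 (lft z y) = y := by
  funext i; rfl

/-- Projection of a lift. [folklore] -/
@[simp] theorem pi3_lft (z : ℤ) (y : Site 2) : pi3 n (lft z y) = ((z : ZMod n), y) := by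
  simp [pi3]

/-- Every point is the lift of its height over its tail. [folklore] -/
theorem lft_eta (x : Site 3) : lft (x 0) (tail3 x) = x := by
  funext i
  refine Fin.cases rfl (fun j => ?_) i
  rfl

/-- Two lifts are equal iff heights and tails are. [folklore] -/
theorem lft_eq_lft_iff {z z' : ℤ} {y y' : Site 2} : lft z y = lft z' y' ↔ z = z' ∧ y = y' := by
  constructor
  · intro h
    exact ⟨by simpa using congrFun h 0, by simpa using congrArg tail3 h⟩
  · rintro ⟨rfl, rfl⟩; rfl

/-- `tail3` is additive. [folklore] -/
theorem tail3_add (x v : Site 3) : tail3 (x + v) = tail3 x + tail3 v := by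
  funext i; rfl

/-- **`π` lifts every direction**: `π(x + dvec d) = nbr (π x) d`. [cite: MartineauSevero2019, §2 (weak lifting property)] -/
theorem pi3_add_dvec (x : Site 3) (d : Dir) : pi3 n (x + dvec d) = nbr (pi3 n x) d := by
  simp only [pi3, nbr, Pi.add_apply, Int.cast_add, tail3_add]

/-- Moving a lift along a direction: `lft z y + dvec d = lft (z + (dvec d)₀) (y + tail(dvec d))`. [folklore] -/
theorem lft_add_dvec (z : ℤ) (y : Site 2) (d : Dir) :
    lft z y + dvec d = lft (z + dvec d 0) (y + tail3 (dvec d)) := by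
  rw [← lft_eta (lft z y + dvec d)]
  simp [tail3_add]

/-- A step along a direction is an edge of `ℤ³`. [folklore] -/
theorem adj_add_dvec (x : Site 3) (d : Dir) : (zdGraph 3).Adj x (x + dvec d) := by
  rw [zdGraph_adj_iff]
  obtain ⟨i, b⟩ := d
  cases b
  · exact ⟨i, Or.inr (by simp [dvec])⟩
  · exact ⟨i, Or.inl (by simp [dvec])⟩

/-- The projection of an edge of `ℤ³`. [folklore] -/
def piE (n : ℕ) (E : Sym2 (Site 3)) : Sym2 (Vert n) := E.map (pi3 n)

/-- Projection of a pair. [folklore] -/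
@[simp] theorem piE_mk (x x' : Site 3) : piE n s(x, x') = s(pi3 n x, pi3 n x') := by
  rw [piE, Sym2.map_mk]

/-! ### Vertical and horizontal edges of `ℤ³` -/

/-- The four horizontal directions: axis `i + 1` and a sign. [folklore] -/
abbrev HDir : Type := Fin 2 × Bool

/-- A horizontal direction as a direction of `ℤ³`. [folklore] -/
def hdir (hd : HDir) : Dir := (hd.1.succ, hd.2)

/-- Horizontal unit vectors have height `0` and a non-zero planar part `± eᵢ`. [folklore] -/
theorem dvec_hdir (hd : HDir) : dvec (hdir hd) 0 = 0 ∧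
    tail3 (dvec (hdir hd)) = if hd.2 then Pi.single hd.1 1 else -Pi.single hd.1 1 :=
  dvec_succ hd.1 hd.2

/-- The planar part of a horizontal unit vector is non-zero. [folklore] -/
theorem tail3_dvec_hdir_ne_zero (hd : HDir) : tail3 (dvec (hdir hd)) ≠ 0 := by
  rw [(dvec_hdir hd).2]
  obtain ⟨i, b⟩ := hd
  cases b
  · simp only [Bool.false_eq_true, if_false, ne_eq, neg_eq_zero]
    intro h
    have := congrFun h i
    simp at this
  · simp only [if_true, ne_eq]
    intro h
    have := congrFun h i
    simp at this

/-- `dvec ∘ hdir` is injective. [folklore] -/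
theorem hdir_injective {hd hd' : HDir} (h : dvec (hdir hd) = dvec (hdir hd')) : hd = hd' := by
  have ht := congrArg tail3 h
  rw [(dvec_hdir hd).2, (dvec_hdir hd').2] at ht
  obtain ⟨i, b⟩ := hd
  obtain ⟨i', b'⟩ := hd'
  have h0 := congrFun ht 0
  have h1 := congrFun ht 1
  fin_cases i <;> fin_cases i' <;> cases b <;> cases b' <;>
    first | rfl | (simp at h0 h1)

/-- The planar parity `χ(y) = (y₀ + y₁) mod 2`, a proper two-colouring of `ℤ²`. [folklore] -/
def chi (y : Site 2) : ℤ := (y 0 + y 1) % 2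

/-- Adjacent columns have opposite parity: `χ(y + tail(dvec hd)) ≠ χ(y)`. [folklore] -/
theorem chi_add_ne (y : Site 2) (hd : HDir) : chi (y + tail3 (dvec (hdir hd))) ≠ chi y := by
  rw [(dvec_hdir hd).2]
  obtain ⟨i, b⟩ := hd
  simp only [chi]
  fin_cases i <;> cases b <;> simp <;> omega

/-- The vertical edge of `ℤ³` from height `z` to `z + 1` over `y`. [folklore] -/
def vE (y : Site 2) (z : ℤ) : Sym2 (Site 3) := s(lft z y, lft (z + 1) y)

/-- The horizontal edge of `ℤ³` at height `z` over `y` in direction `hd`. [folklore] -/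
def hE (y : Site 2) (z : ℤ) (hd : HDir) : Sym2 (Site 3) := s(lft z y, lft z y + dvec (hdir hd))

/-- Vertical edges over `y` are determined by their height. [folklore] -/
theorem vE_injective (y : Site 2) : Function.Injective (vE y) := by
  intro z z' h
  rw [vE, vE, Sym2.eq_iff] at h
  rcases h with ⟨h1, -⟩ | ⟨h1, h2⟩
  · exact (lft_eq_lft_iff.1 h1).1
  · have a := (lft_eq_lft_iff.1 h1).1
    have b := (lft_eq_lft_iff.1 h2).1
    omega

/-- Vertical edges over distinct columns are distinct. [folklore] -/
theorem vE_ne_vE_of_ne {y y' : Site 2} (h : y ≠ y') (z z' : ℤ) : vE y z ≠ vE y' z' := by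
  intro hh
  rw [vE, vE, Sym2.eq_iff] at hh
  rcases hh with ⟨h1, -⟩ | ⟨h1, -⟩
  · exact h (lft_eq_lft_iff.1 h1).2
  · exact h (lft_eq_lft_iff.1 h1).2

/-- A vertical edge is not a horizontal edge. [folklore] -/
theorem vE_ne_hE (y : Site 2) (z : ℤ) (y' : Site 2) (z' : ℤ) (hd : HDir) : vE y z ≠ hE y' z' hd := by
  intro hh
  rw [vE, hE, lft_add_dvec, (dvec_hdir hd).1, add_zero, Sym2.eq_iff] at hh
  rcases hh with ⟨h1, h2⟩ | ⟨h1, h2⟩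
  · have a := (lft_eq_lft_iff.1 h1).1
    have b := (lft_eq_lft_iff.1 h2).1
    omega
  · have a := (lft_eq_lft_iff.1 h1).1
    have b := (lft_eq_lft_iff.1 h2).1
    omega

/-- **Equal horizontal edges over different columns force equal heights and adjacent columns of
opposite parity** — the heart of the parity trick: `hE y z hd = hE y' z' hd'` with `y ≠ y'` implies
`z = z'` and `χ y ≠ χ y'`. [folklore] -/
theorem hE_eq_hE {y y' : Site 2} {z z' : ℤ} {hd hd' : HDir} (h : hE y z hd = hE y' z' hd') (hy : y ≠ y') :
    z = z' ∧ chi y ≠ chi y' := by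
  rw [hE, hE, lft_add_dvec, lft_add_dvec, (dvec_hdir hd).1, (dvec_hdir hd').1, add_zero, add_zero, Sym2.eq_iff] at h
  rcases h with ⟨h1, -⟩ | ⟨h1, h2⟩
  · exact absurd (lft_eq_lft_iff.1 h1).2 hy
  · obtain ⟨hz, hyy⟩ := lft_eq_lft_iff.1 h2
    refine ⟨hz, ?_⟩
    rw [← hyy]
    exact (chi_add_ne y hd).symm

/-- Horizontal edges over one column: equal iff same height and direction. [folklore] -/
theorem hE_injective (y : Site 2) {z z' : ℤ} {hd hd' : HDir} (h : hE y z hd = hE y z' hd') : z = z' ∧ hd = hd' := by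
  rw [hE, hE, Sym2.eq_iff] at h
  rcases h with ⟨h1, h2⟩ | ⟨h1, h2⟩
  · obtain ⟨hz, -⟩ := lft_eq_lft_iff.1 h1
    subst hz
    exact ⟨rfl, hdir_injective (add_left_cancel h2)⟩
  · exfalso
    rw [lft_add_dvec, (dvec_hdir hd).1, add_zero] at h2
    have := (lft_eq_lft_iff.1 h2).2
    have h0 : tail3 (dvec (hdir hd)) = 0 := by
      have := congrArg (fun w => w - y) this
      simpa using this
    exact tail3_dvec_hdir_ne_zero hd h0

/-- Projection of a vertical edge: the cycle edge of the column at the residue of the height.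
[folklore] -/
theorem piE_vE (y : Site 2) (z : ℤ) : piE n (vE y z) = s((((z : ZMod n)), y), ((z : ZMod n) + 1, y)) := by
  rw [vE, piE_mk, pi3_lft, pi3_lft, Int.cast_add, Int.cast_one]

/-- Projection of a horizontal edge: the horizontal `ℋ`-edge at the projected vertex. [folklore] -/
theorem piE_hE (y : Site 2) (z : ℤ) (hd : HDir) :
    piE n (hE y z hd) = s((((z : ZMod n)), y), nbr (((z : ZMod n)), y) (hdir hd)) := by
  rw [hE, piE_mk, pi3_add_dvec, pi3_lft]

/-- Vertical edges are edges of `ℤ³`. [folklore] -/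
theorem vE_mem_edgeSet (y : Site 2) (z : ℤ) : vE y z ∈ (zdGraph 3).edgeSet := by
  have h := adj_add_dvec (lft z y) ((0 : Fin 3), true)
  rw [lft_add_dvec, dvec_zero_true.1, dvec_zero_true.2, add_zero] at h
  exact h

/-- Horizontal edges are edges of `ℤ³`. [folklore] -/
theorem hE_mem_edgeSet (y : Site 2) (z : ℤ) (hd : HDir) : hE y z hd ∈ (zdGraph 3).edgeSet :=
  adj_add_dvec (lft z y) (hdir hd)


/-! ### The horizontal direction between adjacent columns -/

/-- The horizontal direction `hd` with `y' = y + tail(dvec (hdir hd))`, for adjacent `y, y'`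
(junk otherwise). [folklore] -/
noncomputable def hdOf (y y' : Site 2) : HDir :=
  if y' = y + Pi.single 0 1 then ((0 : Fin 2), true)
  else if y' = y + -Pi.single 0 1 then ((0 : Fin 2), false)
  else if y' = y + Pi.single 1 1 then ((1 : Fin 2), true)
  else ((1 : Fin 2), false)

/-- Distinct planar unit vectors. [folklore] -/
theorem single_ne_aux : (Pi.single (1 : Fin 2) (1 : ℤ) : Site 2) ≠ Pi.single 0 1 ∧
    (Pi.single (1 : Fin 2) (1 : ℤ) : Site 2) ≠ -Pi.single 0 1 ∧
    (-Pi.single (1 : Fin 2) (1 : ℤ) : Site 2) ≠ Pi.single 0 1 ∧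
    (-Pi.single (1 : Fin 2) (1 : ℤ) : Site 2) ≠ -Pi.single 0 1 ∧
    (-Pi.single (1 : Fin 2) (1 : ℤ) : Site 2) ≠ Pi.single 1 1 ∧
    (-Pi.single (0 : Fin 2) (1 : ℤ) : Site 2) ≠ Pi.single 0 1 := by
  refine ⟨fun h => ?_, fun h => ?_, fun h => ?_, fun h => ?_, fun h => ?_, fun h => ?_⟩
  · have := congrFun h 0; simp at this
  · have := congrFun h 0; simp at this
  · have := congrFun h 0; simp at this
  · have := congrFun h 0; simp at this
  · have := congrFun h 1; simp at this
  · have := congrFun h 0; simp at this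

/-- `hdOf` recovers the step between adjacent columns. [folklore] -/
theorem hdOf_spec {y y' : Site 2} (h : (zdGraph 2).Adj y y') : y' = y + tail3 (dvec (hdir (hdOf y y'))) := by
  obtain ⟨h1, h2, h3, h4, h5, h6⟩ := single_ne_aux
  rw [zdGraph_adj_iff] at h
  obtain ⟨i, h | h⟩ := h
  · fin_cases i
    · have : hdOf y y' = ((0 : Fin 2), true) := by simp [hdOf, h]
      rw [this, (dvec_hdir _).2]; simpa using h
    · have hne1 : y' ≠ y + Pi.single 0 1 := by rw [h]; simpa using h1
      have hne2 : y' ≠ y + -Pi.single 0 1 := by rw [h]; simpa using h2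
      have : hdOf y y' = ((1 : Fin 2), true) := by
        simp only [hdOf, hne1, hne2, if_false]
        simp [h]
      rw [this, (dvec_hdir _).2]; simpa using h
  · have h' : y' = y + -Pi.single i 1 := by rw [h]; simp
    fin_cases i
    · have hne1 : y' ≠ y + Pi.single 0 1 := by rw [h']; simpa using h6
      have : hdOf y y' = ((0 : Fin 2), false) := by
        simp only [hdOf, hne1, if_false]
        simp [h']
      rw [this, (dvec_hdir _).2]; simpa using h'
    · have hne1 : y' ≠ y + Pi.single 0 1 := by rw [h']; simpa using h3
      have hne2 : y' ≠ y + -Pi.single 0 1 := by rw [h']; simpa using h4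
      have hne3 : y' ≠ y + Pi.single 1 1 := by rw [h']; simpa using h5
      have : hdOf y y' = ((1 : Fin 2), false) := by
        simp only [hdOf, hne1, hne2, hne3, if_false]
      rw [this, (dvec_hdir _).2]; simpa using h'

/-- For adjacent columns, `(t, y') = nbr (t, y) (hdir (hdOf y y'))`. [folklore] -/
theorem nbr_hdOf {y y' : Site 2} (h : (zdGraph 2).Adj y y') (t : ZMod n) :
    nbr ((t, y) : Vert n) (hdir (hdOf y y')) = (t, y') := by
  have hy := hdOf_spec h
  rw [hdir, nbr_succ, ← (dvec_succ _ _).2, ← hdir, ← hy]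

/-! ### Lifts of explored vertices and designated lifts of queried edges -/

section Lifts

/-- The lift `λ(v) = (h v, v.2)` of a vertex at its recorded height. [cite: MartineauSevero2019, §5 (C'_{ℓ,n})] -/
def lam (h : Vert n → ℤ) (v : Vert n) : Site 3 := lft (h v) v.2

/-- **The designated lift** of a queried `ℋ`-edge `e`: the lift at `λ(a)` in direction `d`, where
`(a, d) = src e` records how `e` was queried (Martineau–Severo's `e'`, Condition 1).
[cite: MartineauSevero2019, §5 (Condition 1)] -/
def desig (σ : HState n) (h : Vert n → ℤ) (e : Sym2 (Vert n)) : Sym2 (Site 3) :=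
  s(lam h (σ.src e).1, lam h (σ.src e).1 + dvec (σ.src e).2)

/-- All designated lifts of the state. [cite: MartineauSevero2019, §5 (p-explored edges of 𝒢)] -/
noncomputable def Desig (σ : HState n) (h : Vert n → ℤ) : Finset (Sym2 (Site 3)) := σ.Q.image (desig σ h)

/-- If heights project to residues, `π(λ v) = v`. [folklore] -/
theorem pi3_lam {h : Vert n → ℤ} {v : Vert n} (hv : ((h v : ℤ) : ZMod n) = v.1) : pi3 n (lam h v) = v := by
  rw [lam, pi3_lft, hv]

/-- **A designated lift projects to its edge**: `π(desig e) = e`, provided `e = s(a, nbr a d)` for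
`(a, d) = src e` and the height of `a` projects to its residue. [cite: MartineauSevero2019, §5 (Condition 1)] -/
theorem piE_desig {σ : HState n} {h : Vert n → ℤ} {e : Sym2 (Vert n)}
    (hsrc : e = s((σ.src e).1, nbr (σ.src e).1 (σ.src e).2)) (hres : (((h (σ.src e).1) : ℤ) : ZMod n) = (σ.src e).1.1) :
    piE n (desig σ h e) = e := by
  rw [desig, piE_mk, pi3_add_dvec, pi3_lam hres, ← hsrc]

/-- Designated lifts are edges of `ℤ³`. [folklore] -/
theorem desig_mem_edgeSet (σ : HState n) (h : Vert n → ℤ) (e : Sym2 (Vert n)) : desig σ h e ∈ (zdGraph 3).edgeSet :=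
  adj_add_dvec _ _

/-! ### The bonus probe of a column -/

/-- The height of the lift of `(0, y)`: the bottom of the wrap-around witness. [cite: MartineauSevero2019, §5 (the vertex x ∈ C' ∩ π⁻¹(u))] -/
def baseHt (h : Vert n → ℤ) (y : Site 2) : ℤ := h (((0 : ZMod n)), y)

/-- The sheet index of the base lift. [folklore] -/
def kOf (h : Vert n → ℤ) (y : Site 2) : ℤ := baseHt h y / n

/-- The smaller of the two sheets `j ∈ {0,1,2,3}` above the base with `(k + j) mod 2 = χ(y)`. [folklore] -/
def jlo (h : Vert n → ℤ) (y : Site 2) : ℕ := if kOf h y % 2 = chi y then 0 else 1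

/-- The candidate lift, in sheet `j` above the base, of the horizontal edge at `(t, y)` in direction
`hd`. [cite: MartineauSevero2019, §5 (a lift e' of e ∈ S_{r+1/2}(u) adjacent to Z)] -/
def candH (h : Vert n → ℤ) (y : Site 2) (t : ZMod n) (hd : HDir) (j : ℕ) : Sym2 (Site 3) :=
  hE y (baseHt h y + t.val + j * n) hd

/-- **The chosen sheet**: the parity-`χ(y)` sheet whose candidate is not the designated lift of that
horizontal `ℋ`-edge (M–S: "at least one lift e' of e that is adjacent to Z(x,r) and p-unexplored:
pick the smallest one"). [cite: MartineauSevero2019, §5 (Substep choosing e')] -/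
noncomputable def jstar (σ : HState n) (h : Vert n → ℤ) (y : Site 2) (t : ZMod n) (hd : HDir) : ℕ :=
  if candH h y t hd (jlo h y) = desig σ h s(((t, y) : Vert n), nbr (t, y) (hdir hd)) then jlo h y + 2 else jlo h y

variable (σ : HState n) (h : Vert n → ℤ) (y : Site 2)

/-- The chosen sheet is one of the four above the base. [folklore] -/
theorem jstar_le (t : ZMod n) (hd : HDir) : jstar σ h y t hd ≤ 3 := by
  unfold jstar jlo; split_ifs <;> omega

/-- The smaller parity sheet is `0` or `1`. [folklore] -/
theorem jlo_le : jlo h y ≤ 1 := by unfold jlo; split_ifs <;> omega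

/-- The chosen sheet has parity `χ(y)`: `(k + jstar) mod 2 = χ(y)`. [folklore] -/
theorem jstar_parity (t : ZMod n) (hd : HDir) : (kOf h y + jstar σ h y t hd) % 2 = chi y := by
  have hchi : chi y = 0 ∨ chi y = 1 := by unfold chi; omega
  have hk : kOf h y % 2 = 0 ∨ kOf h y % 2 = 1 := by omega
  unfold jstar jlo
  split_ifs with h1 h2 h2 <;> push_cast <;> omega

variable [NeZero n]

/-- The horizontal part of the bonus probe: one fresh lift per vertex of the column and horizontal
direction. [cite: MartineauSevero2019, §5 (the edges (e', k_e), e ∈ S_{r+1/2}(u))] -/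
noncomputable def D3 (σ : HState n) (h : Vert n → ℤ) (y : Site 2) : Finset (Sym2 (Site 3)) :=
  ((Finset.univ : Finset (ZMod n)) ×ˢ (Finset.univ : Finset HDir)).image
    fun q => candH h y q.1 q.2 (jstar σ h y q.1 q.2)

/-- The `4n` vertical edges over `y` above the base (four sheets: the wrap-around witness `Z`).
[cite: MartineauSevero2019, §5 (Z(x, r))] -/
noncomputable def Seg (h : Vert n → ℤ) (y : Site 2) : Finset (Sym2 (Site 3)) :=
  (Finset.range (4 * n)).image fun i : ℕ => vE y (baseHt h y + (i : ℤ))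

/-- The non-designated edges of the witness: the vertical part of the bonus probe.
[cite: MartineauSevero2019, §5 ("For each p-unexplored edge e' in Z(x,r) …")] -/
noncomputable def D1 (σ : HState n) (h : Vert n → ℤ) (y : Site 2) : Finset (Sym2 (Site 3)) :=
  (Seg h y).filter fun E => E ∉ Desig σ h

/-- The number of designated edges inside the witness. [folklore] -/
noncomputable def mOf (σ : HState n) (h : Vert n → ℤ) (y : Site 2) : ℕ := ((Seg h y).filter fun E => E ∈ Desig σ h).card

/-- The `n` vertical edges over `y` just above the witness (padding candidates). [folklore] -/
noncomputable def Above (h : Vert n → ℤ) (y : Site 2) : Finset (Sym2 (Site 3)) :=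
  (Finset.range n).image fun i : ℕ => vE y (baseHt h y + 4 * n + (i : ℤ))

/-- The non-designated padding candidates. [folklore] -/
noncomputable def nonDes (σ : HState n) (h : Vert n → ℤ) (y : Site 2) : Finset (Sym2 (Site 3)) :=
  (Above h y).filter fun E => E ∉ Desig σ h

/-- **The padding**: as many fresh vertical edges above the witness as there are designated edges
inside it, so that the bonus always reads the same number of coins (replacing M–S's thinning of
`α_u`). [cite: MartineauSevero2019, §5 ("set α_u := 1 with probability s/q ≤ 1")] -/
noncomputable def D2 (σ : HState n) (h : Vert n → ℤ) (y : Site 2) : Finset (Sym2 (Site 3)) :=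
  if hm : mOf σ h y ≤ (nonDes σ h y).card then (Finset.exists_subset_card_eq hm).choose else ∅

/-- **The bonus probe of the column `y`.** [cite: MartineauSevero2019, §5 (Substeps of Step 2K+2)] -/
noncomputable def Dcol (σ : HState n) (h : Vert n → ℤ) (y : Site 2) : Finset (Sym2 (Site 3)) :=
  D1 σ h y ∪ D2 σ h y ∪ D3 σ h y

/-! ### Elementary properties of the bonus probe -/

/-- Candidates in distinct sheets are distinct. [folklore] -/
theorem candH_ne_of_ne (t : ZMod n) (hd : HDir) {j j' : ℕ} (hj : j ≠ j') : candH h y t hd j ≠ candH h y t hd j' := by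
  intro hh
  have hn : (0 : ℤ) < n := by exact_mod_cast Nat.pos_of_ne_zero (NeZero.ne n)
  have := (hE_injective y hh).1
  have : (j : ℤ) * n = (j' : ℤ) * n := by linarith
  have := Int.eq_of_mul_eq_mul_right hn.ne' this
  exact hj (by exact_mod_cast this)

/-- **The chosen lift is not the designated lift of its `ℋ`-edge.** [cite: MartineauSevero2019, §5 ("p-unexplored")] -/
theorem candH_jstar_ne_desig (t : ZMod n) (hd : HDir) :
    candH h y t hd (jstar σ h y t hd) ≠ desig σ h s(((t, y) : Vert n), nbr (t, y) (hdir hd)) := by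
  unfold jstar
  split_ifs with h1
  · rw [← h1]
    exact candH_ne_of_ne h y t hd (by omega)
  · exact h1

omit [NeZero n] in
/-- The witness has `4n` edges. [folklore] -/
theorem card_Seg : (Seg h y).card = 4 * n := by
  rw [Seg, Finset.card_image_of_injective _ fun i i' hh => ?_, Finset.card_range]
  have := vE_injective y hh
  omega

omit [NeZero n] in
/-- There are `n` padding candidates. [folklore] -/
theorem card_Above : (Above h y).card = n := by
  rw [Above, Finset.card_image_of_injective _ fun i i' hh => ?_, Finset.card_range]
  have := vE_injective y hh
  omega

omit [NeZero n] in
/-- The witness and the padding candidates are disjoint. [folklore] -/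
theorem disjoint_Seg_Above : Disjoint (Seg h y) (Above h y) := by
  rw [Finset.disjoint_left]
  intro E hE hA
  obtain ⟨i, hi, rfl⟩ := Finset.mem_image.1 hE
  obtain ⟨i', hi', hh⟩ := Finset.mem_image.1 hA
  rw [Finset.mem_range] at hi hi'
  have := vE_injective y hh
  omega

/-- The horizontal part has `4n` edges. [folklore] -/
theorem card_D3 : (D3 σ h y).card = 4 * n := by
  rw [D3, Finset.card_image_of_injOn, Finset.card_product, Finset.card_univ, Finset.card_univ, ZMod.card]
  · simp [Fintype.card_prod, Fintype.card_bool, mul_comm]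
  rintro ⟨t, hd⟩ - ⟨t', hd'⟩ - hh
  obtain ⟨hz, hhd⟩ := hE_injective y hh
  subst hhd
  have hmod : ((t.val : ℤ) + (jstar σ h y t hd : ℤ) * n) % n = ((t'.val : ℤ) + (jstar σ h y t' hd : ℤ) * n) % n := by
    congr 1; linarith
  rw [Int.add_mul_emod_self_right, Int.add_mul_emod_self_right] at hmod
  have h1 : ((t.val : ℤ)) % n = t.val := Int.emod_eq_of_lt (by positivity) (by exact_mod_cast ZMod.val_lt t)
  have h2 : ((t'.val : ℤ)) % n = t'.val := Int.emod_eq_of_lt (by positivity) (by exact_mod_cast ZMod.val_lt t')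
  rw [h1, h2] at hmod
  have : t = t' := ZMod.val_injective n (by exact_mod_cast hmod)
  subst this
  rfl

/-- Vertical parts and the horizontal part are disjoint. [folklore] -/
theorem disjoint_vertical_D3 : Disjoint (D1 σ h y ∪ D2 σ h y) (D3 σ h y) := by
  rw [Finset.disjoint_left]
  intro E hE hE3
  obtain ⟨⟨t, hd⟩, -, rfl⟩ := Finset.mem_image.1 hE3
  have hvert : ∃ z, candH h y t hd (jstar σ h y t hd) = vE y z := by
    rcases Finset.mem_union.1 hE with hE | hE
    · obtain ⟨hS, -⟩ := Finset.mem_filter.1 hE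
      obtain ⟨i, -, hi⟩ := Finset.mem_image.1 hS
      exact ⟨_, hi.symm⟩
    · unfold D2 at hE
      split_ifs at hE with hm
      · have hsub := (Finset.exists_subset_card_eq hm).choose_spec.1 hE
        obtain ⟨hA, -⟩ := Finset.mem_filter.1 hsub
        obtain ⟨i, -, hi⟩ := Finset.mem_image.1 hA
        exact ⟨_, hi.symm⟩
      · simp at hE
  obtain ⟨z, hz⟩ := hvert
  exact vE_ne_hE y z y _ hd (hz.symm)

omit [NeZero n] in
/-- `D1 ⊆ Seg` and `D2 ⊆ Above`, so `D1` and `D2` are disjoint. [folklore] -/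
theorem disjoint_D1_D2 : Disjoint (D1 σ h y) (D2 σ h y) := by
  refine Finset.disjoint_of_subset_left (Finset.filter_subset _ _) (Finset.disjoint_of_subset_right ?_ (disjoint_Seg_Above h y))
  unfold D2
  split_ifs with hm
  · exact (Finset.exists_subset_card_eq hm).choose_spec.1.trans (Finset.filter_subset _ _)
  · simp

/-- If designated lifts project to their (distinct) edges, at most `n` designated edges are vertical
edges over `y` among the witness and the padding candidates. [cite: MartineauSevero2019, §5 (Condition 4)] -/
theorem card_filter_desig_le (hπ : ∀ e ∈ σ.Q, piE n (desig σ h e) = e) :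
    ((Seg h y ∪ Above h y).filter fun E => E ∈ Desig σ h).card ≤ n := by
  classical
  -- project to the cycle edges of the column
  set cyc : Finset (Sym2 (Vert n)) := (Finset.univ : Finset (ZMod n)).image fun t => s(((t, y) : Vert n), (t + 1, y)) with hcyc
  have hcard : cyc.card ≤ n := by
    refine Finset.card_image_le.trans ?_
    rw [Finset.card_univ, ZMod.card]
  refine le_trans (Finset.card_le_card_of_injOn (piE n) (fun E hE => ?_) ?_) hcard
  · obtain ⟨hE, -⟩ := Finset.mem_filter.1 hE
    simp only [Finset.coe_image, Set.mem_image, Finset.mem_coe, Finset.mem_univ, true_and, hcyc]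
    rcases Finset.mem_union.1 hE with hE | hE
    · obtain ⟨i, -, rfl⟩ := Finset.mem_image.1 hE
      exact ⟨_, (piE_vE y _).symm⟩
    · obtain ⟨i, -, rfl⟩ := Finset.mem_image.1 hE
      exact ⟨_, (piE_vE y _).symm⟩
  · intro E₁ hE₁ E₂ hE₂ hh
    obtain ⟨-, hD₁⟩ := Finset.mem_filter.1 hE₁
    obtain ⟨-, hD₂⟩ := Finset.mem_filter.1 hE₂
    obtain ⟨e₁, he₁, rfl⟩ := Finset.mem_image.1 hD₁
    obtain ⟨e₂, he₂, rfl⟩ := Finset.mem_image.1 hD₂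
    rw [hπ e₁ he₁, hπ e₂ he₂] at hh
    rw [hh]

/-- Under the same hypothesis, the padding is possible: `mOf ≤ |nonDes|`. [folklore] -/
theorem mOf_le_card_nonDes (hπ : ∀ e ∈ σ.Q, piE n (desig σ h e) = e) : mOf σ h y ≤ (nonDes σ h y).card := by
  have h1 := card_filter_desig_le σ h y hπ
  rw [Finset.filter_union, Finset.card_union_of_disjoint
    (Finset.disjoint_filter_filter (disjoint_Seg_Above h y))] at h1
  have h2 := Finset.card_filter_add_card_filter_not (s := Above h y) (fun E => E ∈ Desig σ h)
  rw [card_Above] at h2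
  unfold mOf nonDes
  omega

/-- The padding has `mOf` edges (under the projection hypothesis). [folklore] -/
theorem card_D2 (hπ : ∀ e ∈ σ.Q, piE n (desig σ h e) = e) : (D2 σ h y).card = mOf σ h y := by
  unfold D2
  rw [dif_pos (mOf_le_card_nonDes σ h y hπ)]
  exact (Finset.exists_subset_card_eq (mOf_le_card_nonDes σ h y hπ)).choose_spec.2

/-- **The bonus probe reads exactly `8n` coins** (under the projection hypothesis).
[cite: MartineauSevero2019, §5 (the probability q ≥ s of a successful Substep)] -/
theorem card_Dcol (hπ : ∀ e ∈ σ.Q, piE n (desig σ h e) = e) : (Dcol σ h y).card = 8 * n := by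
  have hD1 : (D1 σ h y).card + mOf σ h y = 4 * n := by
    unfold D1 mOf
    rw [add_comm, Finset.card_filter_add_card_filter_not, card_Seg]
  rw [Dcol, Finset.card_union_of_disjoint (disjoint_vertical_D3 σ h y),
    Finset.card_union_of_disjoint (disjoint_D1_D2 σ h y), card_D2 σ h y hπ, card_D3]
  omega

/-- The bonus probe consists of edges of `ℤ³`. [folklore] -/
theorem Dcol_subset_edgeSet : (↑(Dcol σ h y) : Set (Sym2 (Site 3))) ⊆ (zdGraph 3).edgeSet := by
  intro E hE
  rcases Finset.mem_union.1 hE with hE | hE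
  · rcases Finset.mem_union.1 hE with hE | hE
    · obtain ⟨hS, -⟩ := Finset.mem_filter.1 hE
      obtain ⟨i, -, rfl⟩ := Finset.mem_image.1 hS
      exact vE_mem_edgeSet y _
    · unfold D2 at hE
      split_ifs at hE with hm
      · obtain ⟨hA, -⟩ := Finset.mem_filter.1 ((Finset.exists_subset_card_eq hm).choose_spec.1 hE)
        obtain ⟨i, -, rfl⟩ := Finset.mem_image.1 hA
        exact vE_mem_edgeSet y _
      · simp at hE
  · obtain ⟨⟨t, hd⟩, -, rfl⟩ := Finset.mem_image.1 hE
    exact hE_mem_edgeSet y _ hd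

/-- **No coin of the bonus probe is a designated lift** (vertical parts by construction, horizontal
part by the choice of the sheet), when designated lifts project to their edges.
[cite: MartineauSevero2019, §5 (s-explored edges are p-unexplored)] -/
theorem Dcol_disjoint_Desig (hπ : ∀ e ∈ σ.Q, piE n (desig σ h e) = e)
    (hbase : ((baseHt h y : ℤ) : ZMod n) = 0) : Disjoint (Dcol σ h y) (Desig σ h) := by
  rw [Finset.disjoint_left]
  intro E hE hD
  rcases Finset.mem_union.1 hE with hE | hE
  · rcases Finset.mem_union.1 hE with hE | hE
    · exact (Finset.mem_filter.1 hE).2 hD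
    · unfold D2 at hE
      split_ifs at hE with hm
      · exact (Finset.mem_filter.1 ((Finset.exists_subset_card_eq hm).choose_spec.1 hE)).2 hD
      · simp at hE
  · obtain ⟨⟨t, hd⟩, -, rfl⟩ := Finset.mem_image.1 hE
    obtain ⟨e, he, hde⟩ := Finset.mem_image.1 hD
    -- the designated edge projects to the same `ℋ`-edge, hence is the excluded one
    have hproj : e = s(((t, y) : Vert n), nbr (t, y) (hdir hd)) := by
      rw [← hπ e he, hde, candH, piE_hE]
      have : (((baseHt h y + (t.val : ℤ) + (jstar σ h y t hd : ℤ) * n : ℤ)) : ZMod n) = t := by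
        push_cast
        rw [hbase, ZMod.natCast_zmod_val, ZMod.natCast_self]
        ring
      rw [this]
    subst hproj
    exact candH_jstar_ne_desig σ h y t hd hde.symm

end Lifts

end SlabTorus

end Literature.Probability.Percolation
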